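import Summits.Ventures.PercRepro.MSTightExtSideAll
import Summits.Ventures.PercRepro.MSTightConjTSingleton

/-!
# Conjecture (T) in the residue setting

Dossier proofs/MINE1-theoremS.md, Addendum 54 supplement 4. At a tightening direction `r` of a
family `F` of Marica–Schönheim excess one whose trace `proj r F` is tight, twin-free and genuine
(`∅ ∉ P`, empty core, `univ.erase r ∉ P`, full support off `r`), **every type-I difference is an
`r`-free difference**: `diffsY r F ⊆ diffsX r F` — provided the partner family is nonempty.
Proof: the tightening split (`tightening_split`) puts `r` in case (α) (partner family tight,
`X ∩ Y = K \\ K ⊔ {e}`) or case (β) (partner family of excess one, `X ∩ Y = K \\ K`); case (α)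
is `diffsY_subset_diffsX_of_tight_partner` (p445068); in case (β) a singleton side is
`diffsY_subset_diffsX_of_part0_subsingleton` / `_partr_subsingleton` (p449345), and the open
shape (both sides of size `≥ 2`) is the bridge `diffsY_subset_diffsX_of_localDichotomyGenuine`
(p507397) fed with `localDichotomyGenuine` (MSTightExtSideAll).

The hypothesis `(partner r F).Nonempty` is automatic in case (β); in case (α) with an empty
partner family one side is a singleton on the whole census of [4]–[5] (0 of 2,076 such `(F, r)`
have both sides of size `≥ 2`) — the paper proof of that sub-case is left to the successor.
-/

namespace PercRepro.MSTight

open Finset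
open scoped FinsetFamily

variable {α : Type*} [DecidableEq α] [Fintype α]

/-- **Conjecture (T) in the residue setting** (with a nonempty partner family). -/
theorem diffsY_subset_diffsX_of_residue {r : α} {F : Finset (Finset α)}
    (hF : (F \\ F).card = F.card + 1) (hP : Tight (proj r F))
    (htf : ∀ a b, Twin (proj r F) a b → a = b)
    (hE : (∅ : Finset α) ∉ proj r F) (hcore : ∀ a, ∃ p ∈ proj r F, a ∉ p)
    (hS : univ.erase r ∉ proj r F) (hsupp : ∀ a, a ≠ r → ∃ p ∈ proj r F, a ∈ p)
    (hK : (partner r F).Nonempty) : diffsY r F ⊆ diffsX r F := by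
  rcases tightening_split hF hP with ⟨hT, e, he, hXY⟩ | ⟨hβ, -, -, -⟩
  · exact diffsY_subset_diffsX_of_tight_partner hP htf hT hK he hXY
  · by_cases h0 : 2 ≤ (part0 r F \ partr r F).card
    · by_cases h1 : 2 ≤ (partr r F \ part0 r F).card
      · exact diffsY_subset_diffsX_of_localDichotomyGenuine (localDichotomyGenuine α) hF hP htf hE
          hcore hS hsupp hβ h0 h1
      · apply diffsY_subset_diffsX_of_partr_subsingleton hP htf hcore hE
        intro t ht ht0 t' ht' ht'0
        have hle : (partr r F \ part0 r F).card ≤ 1 := by omega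
        exact card_le_one.1 hle t (mem_sdiff.2 ⟨ht, ht0⟩) t' (mem_sdiff.2 ⟨ht', ht'0⟩)
    · apply diffsY_subset_diffsX_of_part0_subsingleton hP htf hsupp hS
      intro s hs hs1 s' hs' hs'1
      have hle : (part0 r F \ partr r F).card ≤ 1 := by omega
      exact card_le_one.1 hle s (mem_sdiff.2 ⟨hs, hs1⟩) s' (mem_sdiff.2 ⟨hs', hs'1⟩)

end PercRepro.MSTight
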